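import Summits.HodgeConjecture.CorCM.Census.HalfParityCharacters

/-!
# The half-parity law, XIII: THE COUNT — `t(G, c) = dim_𝔽₂{stabiliser characters} − [|G|/2 even ∧ δ = 0]`, so
# `φ₂(G, c) + 1 + [|G|/2 even] = β(G, c) + dim_𝔽₂{stabiliser characters}`

COR-CM (cell `pub-hodgecm2`), count-neutral kernel combinatorics by the binder seat b09 (gen 31; lane DIRECT-FACTOR, sequel
«CLOSED-FORM LAW» = lit-andre-3ʼs A6-R55 / corollaries (i)–(iii)), part XIII of the HALF-PARITY series, sequel of
`Census/HalfParityCharacters.lean` (XII).  Three bookkeeping definitions with bodies (`charK`, the `𝔽₂`-space of stabiliser characters;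
`signChar`, the sign character of a subgroup; `resK`, the restriction of the character functionals to the fibre kernel) + theorems; no `decide` beyond closed identities in `𝔽₂`, no
certificate, no named fact, no `sorry`.  HONEST FRAMING: `HC_CM` is NOT proved; nothing here is a period or a headline.

THE THEOREM (`fibreTwo_add_eq_card_block_add_finrank_charK`).  For every finite group `G` and central involution `c ≠ 1`, with
`𝔛(G,c) = charK` the `𝔽₂`-space of additive maps `χ : G → 𝔽₂` with `χ(c) = 0` killing the stabiliser of every CM type
(`≅ Hom(G/𝒦, 𝔽₂)`, `𝒦 = ⟨c, stab Ψ : Ψ⟩`, lit-andre-3ʼs `d₂(G/𝒦) = dim 𝔛`):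
**`φ₂(G, c) + 1 + [|G|/2 even] = β(G, c) + dim_𝔽₂ 𝔛(G, c)`**, equivalently (`halfRank_add_eq_finrank_charK`)
**`t(G, c) + [|G|/2 even] = dim 𝔛 + δ`** — ANDRÉ-3ʼS LAW IN CLOSED FORM: the coinvariant fibre of the Hodge lattice of a Galois CM
field is a one-line function of (number of blocks, parity of `n`, number of sign characters of `Gal` killing `conj` and every
CM-type stabiliser) — numerically `≈ 100` pairs `(G, c)` of order `≤ 32` (b09 g31 `law_conj.py`, lit-andre-3 g18 `closedform.py`).

PROOF.  `t = dim (θ_χ)_{χ ∈ 𝔛}(hodge2 ∩ ker par2)` (the `θ_χ` kill `rad2` and their joint kernel on `hodge2 ∩ ker par2` lies in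
`rad2` by XI, since the stabiliser half-parities are among them; squeeze by the LAW X) `= dim range(resK)` (row rank = column rank,
`LinearMap.finrank_range_dualMap_eq_finrank_range`, linearity of `χ ↦ θ_χ`) `= dim 𝔛 − dim ker(resK)`, and `ker(resK) = 0` unless
`|G|/2` is even and `δ = 0`, when it is the line spanned by the transfer parity (XII `char_eq_zero_or_transfer`,
`theta_transfer_eq_zero`).

## References
* [Pohlmann1968] H. Pohlmann, Algebraic cycles on abelian varieties of complex multiplication type, Ann. of Math. 88 (1968), Thm 1.
-/

namespace Summit.HodgeConjecture.CorCM.Census.HalfParity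

open Finset
open Summit.HodgeConjecture.CorCM.Prior.AllgGroup.RfwfAllgGroup
open Summit.HodgeConjecture.CorCM.Census.BlockParity
open Summit.HodgeConjecture.CorCM.Census.Coinvariant

noncomputable section

variable {G : Type*} [Group G] [Fintype G] [DecidableEq G] (c : G)

/-! ## §1 The space of stabiliser characters -/

/-- **The stabiliser characters** `𝔛(G, c)`: additive `χ : G → 𝔽₂` with `χ(c) = 0` killing every stabiliser. [folklore] -/
def charK : Submodule (ZMod 2) (G → ZMod 2) where
  carrier := {χ | (∀ a b : G, χ (a * b) = χ a + χ b) ∧ χ c = 0 ∧ ∀ (Ψ : CMF G c) (Q : G), rt c Q Ψ = Ψ → χ Q = 0}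
  add_mem' := fun {χ₁ χ₂} h₁ h₂ => ⟨fun a b => by rw [Pi.add_apply, Pi.add_apply, Pi.add_apply, h₁.1, h₂.1]; ring,
    by rw [Pi.add_apply, h₁.2.1, h₂.2.1, add_zero], fun Ψ Q hQ => by rw [Pi.add_apply, h₁.2.2 Ψ Q hQ, h₂.2.2 Ψ Q hQ, add_zero]⟩
  zero_mem' := ⟨fun _ _ => by simp, rfl, fun _ _ _ => rfl⟩
  smul_mem' := fun r χ h => ⟨fun a b => by rw [Pi.smul_apply, Pi.smul_apply, Pi.smul_apply, h.1, smul_add],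
    by rw [Pi.smul_apply, h.2.1, smul_zero], fun Ψ Q hQ => by rw [Pi.smul_apply, h.2.2 Ψ Q hQ, smul_zero]⟩

/-- Membership in `charK`. [folklore] -/
theorem mem_charK (χ : G → ZMod 2) : χ ∈ charK c ↔
    (∀ a b : G, χ (a * b) = χ a + χ b) ∧ χ c = 0 ∧ ∀ (Ψ : CMF G c) (Q : G), rt c Q Ψ = Ψ → χ Q = 0 := Iff.rfl

/-- **The sign character** of a subgroup: `0` on `H`, `1` off `H`. [folklore] -/
def signChar (H : Subgroup G) : G → ZMod 2 := fun Q => by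
  classical
  exact if Q ∈ H then 0 else 1

omit [Fintype G] [DecidableEq G] in
/-- The sign character vanishes on `H`. [folklore] -/
theorem signChar_of_mem {H : Subgroup G} {Q : G} (hQ : Q ∈ H) : signChar H Q = 0 := by
  unfold signChar; rw [if_pos hQ]

omit [Fintype G] [DecidableEq G] in
/-- The sign character is `1` off `H`. [folklore] -/
theorem signChar_of_notMem {H : Subgroup G} {Q : G} (hQ : Q ∉ H) : signChar H Q = 1 := by
  unfold signChar; rw [if_neg hQ]

omit [Fintype G] [DecidableEq G] in
/-- The sign character of an index-two subgroup is additive. [folklore] -/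
theorem signChar_mul {H : Subgroup G} (hH : H.index = 2) (a b : G) : signChar H (a * b) = signChar H a + signChar H b := by
  have h := Subgroup.mul_mem_iff_of_index_two hH (a := a) (b := b)
  by_cases ha : a ∈ H <;> by_cases hb : b ∈ H
  · rw [signChar_of_mem ha, signChar_of_mem hb, signChar_of_mem (h.mpr (iff_of_true ha hb))]; decide
  · rw [signChar_of_mem ha, signChar_of_notMem hb, signChar_of_notMem (fun hab => hb ((h.mp hab).mp ha))]; decide
  · rw [signChar_of_notMem ha, signChar_of_mem hb, signChar_of_notMem (fun hab => ha ((h.mp hab).mpr hb))]; decide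
  · rw [signChar_of_notMem ha, signChar_of_notMem hb, signChar_of_mem (h.mpr (iff_of_false ha hb))]; decide

/-- **The sign character of an index-two subgroup `H ∋ c` through all stabilisers is a stabiliser character.** [folklore] -/
theorem signChar_mem_charK {H : Subgroup G} (hH : H.index = 2) (hcH : c ∈ H) (hst : ∀ Ψ : CMF G c, stab c Ψ ≤ H) :
    signChar H ∈ charK c :=
  ⟨signChar_mul hH, signChar_of_mem hcH, fun Ψ Q hQ => signChar_of_mem (hst Ψ ((mem_stab c Ψ Q).mpr hQ))⟩

omit [Fintype G] [DecidableEq G] in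
/-- The kernel of the sign character is the subgroup. [folklore] -/
theorem addKer_signChar {H : Subgroup G} (hH : H.index = 2) : addKer (signChar H) (signChar_mul hH) = H := by
  ext Q
  rw [mem_addKer]
  by_cases hQ : Q ∈ H
  · rw [signChar_of_mem hQ]; exact iff_of_true rfl hQ
  · rw [signChar_of_notMem hQ]; exact iff_of_false (by decide) hQ

/-! ## §2 The joint evaluation against all stabiliser characters detects exactly `t` -/

/-- `θ` is homogeneous in the character. [folklore] -/
theorem theta_smul (r : ZMod 2) (χ : G → ZMod 2) : theta c (r • χ) = r • theta c χ := by
  refine LinearMap.ext fun v => ?_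
  induction v using Finsupp.induction_linear with
  | zero => simp
  | add f g hf hg => rw [map_add, map_add, hf, hg]
  | single Ψ a => rw [LinearMap.smul_apply, theta_single, theta_single, Pi.smul_apply, smul_eq_mul, smul_eq_mul]; ring

/-- The joint evaluation `v ↦ (θ_χ v)_{χ ∈ 𝔛}` kills `rad2`. [folklore] -/
theorem rad2_le_ker_pi_theta (hc2 : c * c = 1) (hcen : ∀ x : G, x * c = c * x) :
    rad2 c hc2 ≤ LinearMap.ker (LinearMap.pi fun χ : ↥(charK c) => theta c χ.1) := by
  intro x hx
  rw [LinearMap.mem_ker]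
  funext χ
  rw [LinearMap.pi_apply, Pi.zero_apply]
  exact LinearMap.mem_ker.mp (rad2_le_ker_theta c χ.2.1 χ.2.2.2 hc2 hcen χ.2.2.1 hx)

/-- **The joint kernel of all `θ_χ` on `hodge2 ∩ ker par2` lies in `rad2`** (XI: the stabiliser half-parities are among them).
[folklore] -/
theorem inf_ker_par2_prod_pi_theta_le_rad2 (hc2 : c * c = 1) (hc1 : c ≠ 1) (hcen : ∀ x : G, x * c = c * x) :
    hodge2 c hc2 ⊓ LinearMap.ker ((par2 c).prod (LinearMap.pi fun χ : ↥(charK c) => theta c χ.1)) ≤ rad2 c hc2 := by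
  classical
  rintro x ⟨hx, hk⟩
  rw [SetLike.mem_coe, LinearMap.mem_ker, LinearMap.prod_apply, Prod.mk_eq_zero] at hk
  refine mem_rad2_of_par2_eq_zero_of_forall_hsum_halfOf_eq_zero c hc2 hc1 hcen hx hk.1 fun H hH hcH hst => ?_
  have hχ := signChar_mem_charK c hH hcH hst
  have h := congrFun hk.2 ⟨_, hχ⟩
  change theta c (signChar H) x = 0 at h
  rw [theta_eq_hsum_halfOf_add_mass c (signChar_mul hH) hχ.2.2, addKer_signChar hH,
    mass_eq_zero_of_mem_hodge2 c hc2 hcen hx, add_zero] at h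
  exact h

/-- **`t = dim (θ_χ)_{χ ∈ 𝔛}(hodge2 ∩ ker par2)`.** [folklore] -/
theorem halfRank_eq_finrank_map_pi_theta (hc2 : c * c = 1) (hc1 : c ≠ 1) (hcen : ∀ x : G, x * c = c * x) :
    halfRank c hc2 = Module.finrank (ZMod 2) ↥((hodge2 c hc2 ⊓ LinearMap.ker (par2 c)).map
      (LinearMap.pi fun χ : ↥(charK c) => theta c χ.1)) := by
  obtain ⟨T, hT⟩ := exists_isCMF c hc2 hc1
  have h0 := card_block_add_finrank_le_fibreTwo_add c hc2 ⟨T, hT⟩ _ (rad2_le_ker_pi_theta c hc2 hcen)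
  have h1 := finrank_rad2_add_fibreTwo c hc2
  have h2 := finrank_map_add_finrank_inf_ker ((par2 c).prod (LinearMap.pi fun χ : ↥(charK c) => theta c χ.1)) (hodge2 c hc2)
  have h3 := Submodule.finrank_mono (inf_ker_par2_prod_pi_theta_le_rad2 c hc2 hc1 hcen)
  have h4 := finrank_map_prod_eq (par2 c) (LinearMap.pi fun χ : ↥(charK c) => theta c χ.1) (hodge2 c hc2)
  have h5 := finrank_map_par2_hodge2_add c hc2 ⟨T, hT⟩
  have h6 := card_block_add_halfRank_eq_fibreTwo_add c hc2 hc1 hcen ⟨T, hT⟩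
  omega

/-! ## §3 The restriction map `resK : 𝔛 → (hodge2 ∩ ker par2)^*` and row rank = column rank -/

/-- **Restriction of `θ_χ` to the fibre kernel**, linear in `χ`. [folklore] -/
def resK (hc2 : c * c = 1) :
    ↥(charK c) →ₗ[ZMod 2] (↥(hodge2 c hc2 ⊓ LinearMap.ker (par2 c)) →ₗ[ZMod 2] ZMod 2) where
  toFun χ := (theta c χ.1).domRestrict _
  map_add' χ₁ χ₂ := by
    ext x
    simp only [LinearMap.domRestrict_apply, LinearMap.add_apply, Submodule.coe_add, theta_add]
  map_smul' r χ := by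
    ext x
    simp only [LinearMap.domRestrict_apply, LinearMap.smul_apply, Submodule.coe_smul, theta_smul, RingHom.id_apply]

/-- The value of `resK`. [folklore] -/
@[simp] theorem resK_apply (hc2 : c * c = 1) (χ : ↥(charK c)) (x : ↥(hodge2 c hc2 ⊓ LinearMap.ker (par2 c))) :
    resK c hc2 χ x = theta c χ.1 x.1 := rfl

/-- **Row rank = column rank**: `dim (θ_χ)_χ(hodge2 ∩ ker par2) = dim range(resK)`. [folklore] -/
theorem finrank_map_pi_theta_eq_finrank_range_resK (hc2 : c * c = 1) :
    Module.finrank (ZMod 2) ↥((hodge2 c hc2 ⊓ LinearMap.ker (par2 c)).map (LinearMap.pi fun χ : ↥(charK c) => theta c χ.1)) =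
      Module.finrank (ZMod 2) ↥(LinearMap.range (resK c hc2)) := by
  classical
  haveI : Fintype ↥(charK c) := Fintype.ofFinite _
  set K₀ := hodge2 c hc2 ⊓ LinearMap.ker (par2 c) with hK₀
  set f : ↥K₀ →ₗ[ZMod 2] (↥(charK c) → ZMod 2) := (LinearMap.pi fun χ : ↥(charK c) => theta c χ.1).domRestrict K₀ with hf
  have hrange : K₀.map (LinearMap.pi fun χ : ↥(charK c) => theta c χ.1) = LinearMap.range f := by
    rw [hf, LinearMap.range_domRestrict]
  rw [hrange, ← LinearMap.finrank_range_dualMap_eq_finrank_range f]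
  have hr : LinearMap.range f.dualMap = LinearMap.range (resK c hc2) := by
    apply le_antisymm
    · rintro _ ⟨φ, rfl⟩
      refine ⟨∑ χ : ↥(charK c), φ (fun j => if χ = j then 1 else 0) • χ, ?_⟩
      refine LinearMap.ext fun x => ?_
      rw [LinearMap.dualMap_apply, resK_apply, Submodule.coe_sum, theta_sum, LinearMap.sum_apply, hf,
        LinearMap.domRestrict_apply, LinearMap.pi_apply_eq_sum_univ φ]
      refine Finset.sum_congr rfl fun χ _ => ?_
      rw [Submodule.coe_smul, theta_smul, LinearMap.smul_apply, LinearMap.pi_apply, smul_eq_mul, smul_eq_mul, mul_comm]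
    · rintro _ ⟨χ, rfl⟩
      refine ⟨LinearMap.proj χ, ?_⟩
      refine LinearMap.ext fun x => ?_
      rw [LinearMap.dualMap_apply, resK_apply, hf, LinearMap.domRestrict_apply, LinearMap.proj_apply, LinearMap.pi_apply]
  rw [hr]

/-! ## §4 The kernel of `resK`: trivial, or the transfer line -/

/-- Membership in `ker resK`. [folklore] -/
theorem mem_ker_resK_iff (hc2 : c * c = 1) (χ : ↥(charK c)) :
    χ ∈ LinearMap.ker (resK c hc2) ↔ ∀ x ∈ hodge2 c hc2, par2 c x = 0 → theta c χ.1 x = 0 := by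
  rw [LinearMap.mem_ker]
  constructor
  · intro h x hx hpx
    have e := LinearMap.congr_fun h ⟨x, Submodule.mem_inf.mpr ⟨hx, LinearMap.mem_ker.mpr hpx⟩⟩
    rwa [resK_apply, LinearMap.zero_apply] at e
  · intro h
    ext x
    rw [resK_apply, LinearMap.zero_apply]
    exact h x.1 (Submodule.mem_inf.mp x.2).1 (LinearMap.mem_ker.mp (Submodule.mem_inf.mp x.2).2)

/-- **No transfer line**: if NOT (`|G|/2` even and `δ = 0`), `ker resK = ⊥`. [folklore] -/
theorem ker_resK_eq_bot (hc2 : c * c = 1) (hc1 : c ≠ 1) (hcen : ∀ x : G, x * c = c * x) (T₀ : CMF G c)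
    (h : ¬ (Even (Fintype.card G / 2) ∧ wdelta c T₀ = 0)) : LinearMap.ker (resK c hc2) = ⊥ := by
  refine (Submodule.eq_bot_iff _).mpr fun χ hχ => ?_
  rcases char_eq_zero_or_transfer c hc2 hc1 hcen χ.2.1 χ.2.2.2 ((mem_ker_resK_iff c hc2 χ).mp hχ) T₀ with h0 | ⟨heven, hV⟩
  · exact Subtype.ext (funext h0)
  · -- then the weight parity moves (`δ = 0`) unless `χ = 0`
    by_cases hinv : ∀ (Q : G) (Ψ : CMF G c), wpar c T₀ (rt c Q Ψ) = wpar c T₀ Ψ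
    · refine Subtype.ext (funext fun Q => ?_)
      rw [hV Q, (invariant_iff_self c hc2 T₀).mp hinv Q]
      rfl
    · exact absurd ⟨heven, wdelta_eq_zero c hinv⟩ h

/-- **The transfer line**: if `|G|/2` is even and `δ = 0`, `ker resK` is the line spanned by the transfer parity. [folklore] -/
theorem finrank_ker_resK_eq_one (hc2 : c * c = 1) (hc1 : c ≠ 1) (hcen : ∀ x : G, x * c = c * x) (T₀ : CMF G c)
    (heven : Even (Fintype.card G / 2)) (hδ : wdelta c T₀ = 0) :
    Module.finrank (ZMod 2) ↥(LinearMap.ker (resK c hc2)) = 1 := by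
  obtain ⟨hadd, hc0, hst⟩ := transfer_char c hc2 hc1 hcen heven T₀
  set V : ↥(charK c) := ⟨fun Q => wpar c T₀ (rt c Q T₀), hadd, hc0, hst⟩ with hVdef
  have hV0 : V ≠ 0 := by
    intro h
    have hinv : ∀ Q : G, wpar c T₀ (rt c Q T₀) = 0 := fun Q => by
      have e := congrArg (fun χ : ↥(charK c) => χ.1 Q) h
      exact e
    have h1 := wdelta_eq_one c ((invariant_iff_self c hc2 T₀).mpr hinv)
    rw [hδ] at h1
    exact absurd h1 (by norm_num)
  have hker : LinearMap.ker (resK c hc2) = Submodule.span (ZMod 2) {V} := by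
    apply le_antisymm
    · intro χ hχ
      rcases char_eq_zero_or_transfer c hc2 hc1 hcen χ.2.1 χ.2.2.2 ((mem_ker_resK_iff c hc2 χ).mp hχ) T₀ with h0 | ⟨-, hVχ⟩
      · have : χ = 0 := Subtype.ext (funext h0)
        rw [this]; exact Submodule.zero_mem _
      · have : χ = V := Subtype.ext (funext hVχ)
        rw [this]; exact Submodule.mem_span_singleton_self V
    · rw [Submodule.span_le, Set.singleton_subset_iff, SetLike.mem_coe, mem_ker_resK_iff]
      exact fun x hx hpx => theta_transfer_eq_zero c hc2 hc1 hcen heven T₀ hx hpx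
  rw [hker, finrank_span_singleton hV0]

/-! ## §5 THE COUNT -/

/-- **`t + dim ker(resK) = dim 𝔛`.** [folklore] -/
theorem halfRank_add_finrank_ker_eq (hc2 : c * c = 1) (hc1 : c ≠ 1) (hcen : ∀ x : G, x * c = c * x) :
    halfRank c hc2 + Module.finrank (ZMod 2) ↥(LinearMap.ker (resK c hc2)) = Module.finrank (ZMod 2) ↥(charK c) := by
  rw [halfRank_eq_finrank_map_pi_theta c hc2 hc1 hcen, finrank_map_pi_theta_eq_finrank_range_resK]
  exact LinearMap.finrank_range_add_finrank_ker (resK c hc2)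

/-- **THE COUNT: `t(G, c) + [|G|/2 even] = dim 𝔛(G, c) + δ(G, c)`.** [folklore] -/
theorem halfRank_add_eq_finrank_charK (hc2 : c * c = 1) (hc1 : c ≠ 1) (hcen : ∀ x : G, x * c = c * x) (T₀ : CMF G c) :
    halfRank c hc2 + (if Even (Fintype.card G / 2) then 1 else 0) =
      Module.finrank (ZMod 2) ↥(charK c) + wdelta c T₀ := by
  have h := halfRank_add_finrank_ker_eq c hc2 hc1 hcen
  have hδ := wdelta_le_one c T₀
  by_cases hev : Even (Fintype.card G / 2)
  · rw [if_pos hev]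
    by_cases hd : wdelta c T₀ = 0
    · rw [finrank_ker_resK_eq_one c hc2 hc1 hcen T₀ hev hd] at h
      omega
    · rw [ker_resK_eq_bot c hc2 hc1 hcen T₀ (fun h' => hd h'.2), finrank_bot] at h
      omega
  · rw [if_neg hev]
    -- `|G|/2` odd forces `δ = 0` (`cⁿ = c ≠ 1`)
    have hd : wdelta c T₀ = 0 := by
      refine wdelta_eq_zero_of_pow_ne_one c hc2 hc1 hcen T₀ (g := c) ?_
      obtain ⟨k, hk⟩ := Nat.not_even_iff_odd.mp hev
      rw [hk, pow_succ, pow_mul, pow_two, hc2, one_pow, one_mul]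
      exact hc1
    rw [ker_resK_eq_bot c hc2 hc1 hcen T₀ (fun h' => hev h'.1), finrank_bot] at h
    omega

/-- **ANDRÉ-3ʼS LAW IN CLOSED FORM: `φ₂(G, c) + 1 + [|G|/2 even] = β(G, c) + dim_𝔽₂ 𝔛(G, c)`.** [folklore] -/
theorem fibreTwo_add_eq_card_block_add_finrank_charK (hc2 : c * c = 1) (hc1 : c ≠ 1) (hcen : ∀ x : G, x * c = c * x) :
    fibreTwo c hc2 + 1 + (if Even (Fintype.card G / 2) then 1 else 0) =
      Fintype.card (Block c) + Module.finrank (ZMod 2) ↥(charK c) := by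
  obtain ⟨T, hT⟩ := exists_isCMF c hc2 hc1
  have h1 := halfRank_add_eq_finrank_charK c hc2 hc1 hcen ⟨T, hT⟩
  have h2 := card_block_add_halfRank_eq_fibreTwo_add c hc2 hc1 hcen ⟨T, hT⟩
  omega

/-- **`|G|/2` even: `φ₂ + 2 = β + dim 𝔛`** (e.g. `Q₈`: `2 + 2 = 2 + 2`; cyclic `ℤ/4k`: `φ₂ + 2 = β + 1`; complemented: `dim 𝔛 = 0`).
[folklore] -/
theorem fibreTwo_add_two_eq_of_even (hc2 : c * c = 1) (hc1 : c ≠ 1) (hcen : ∀ x : G, x * c = c * x)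
    (heven : Even (Fintype.card G / 2)) :
    fibreTwo c hc2 + 2 = Fintype.card (Block c) + Module.finrank (ZMod 2) ↥(charK c) := by
  have h := fibreTwo_add_eq_card_block_add_finrank_charK c hc2 hc1 hcen
  rw [if_pos heven] at h
  omega

/-- **`|G|/2` odd: `φ₂ + 1 = β + dim 𝔛`** (and part X of gen 29: `dim 𝔛 = 0` then). [folklore] -/
theorem fibreTwo_add_one_eq_of_odd (hc2 : c * c = 1) (hc1 : c ≠ 1) (hcen : ∀ x : G, x * c = c * x)
    (hodd : Odd (Fintype.card G / 2)) :
    fibreTwo c hc2 + 1 = Fintype.card (Block c) + Module.finrank (ZMod 2) ↥(charK c) := by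
  have h := fibreTwo_add_eq_card_block_add_finrank_charK c hc2 hc1 hcen
  rw [if_neg (Nat.not_even_iff_odd.mpr hodd)] at h
  omega

end

end Summit.HodgeConjecture.CorCM.Census.HalfParity
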